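import Literature.Computability.QuantumComplexity.GoldenCyclotomicArithmetic
import Literature.Computability.Complexity.CodeFPLists
import HarnessLib

/-!
# Typed polynomial time for the golden arithmetic of the braid compiler

Topic `Literature/Computability/QuantumComplexity`. String-level (Karp-reduction) layer of the
`PromiseBQP`-hardness of the Jones polynomial (Aharonov–Arad 2011, Thm. 3.1): the reduction
machine runs the exact braid compiler (`ExactCompilerDefs.lean`), whose scalars live in the
nested quadratic rings `ZPhi = ℤ[φ]`, `ZPhiS = ℤ[φ][√τ]`, `ZPhiZeta = ℤ[φ][ζ₅]` and
`K5 = ℤ[φ][ζ₅][√τ]` (`GoldenArithmetic.lean`, `GoldenCyclotomicArithmetic.lean`, all Mathlib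
`QuadraticAlgebra`s) and whose only decisions are the exact sign tests `ZPhi.pos`, `ZPhiS.pos`.
In the typed `FP` algebra `CodeFP` (`Complexity/CodeFP*.lean`) we provide:

* `RingCodeFP eR` — an injective code of a commutative ring with `+`, `-`, `*` computed on codes,
  and its pointwise combinators; `RingCodeFP.int` (the tree's `intE`);
* `qaE eR` — the code of `QuadraticAlgebra R a b` as the pair of coordinate codes, and
  **`RingCodeFP.qa`**: the quadratic algebra over a `RingCodeFP` ring is one (`re`, `im`, `mk`,
  `star` as well); whence the codes `zphiE`, `zphisE`, `zzE`, `k5E` and their ring structure;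
* the sign tests `posSqrtFive_codeFP`, `zphiPos`, `zphiLt`, `zphisPos`, `zphisLt`.

## References

* D. Aharonov, I. Arad, New J. Phys. 13 (2011) 035019, §3.3 (the classical pre-compilation is
  polynomial) [AharonovArad2011].
* S. Arora, B. Barak, *Computational Complexity*, CUP 2009, §1.2–1.3 [AroraBarak2009].
-/

namespace Literature.Computability.QuantumComplexity

open Literature.Computability.Complexity Literature.Computability.Complexity.CodeFP

/-! ### Rings computed on codes -/

/-- **A commutative ring computed on codes**: an injective code with addition, negation and
multiplication in typed polynomial time. [cite: AroraBarak2009, §1.3] -/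
structure RingCodeFP {R : Type} [CommRing R] (eR : R → List Bool) : Prop where
  inj : Function.Injective eR
  add : CodeFP (pairE eR eR) eR (fun p => p.1 + p.2)
  neg : CodeFP eR eR (fun x => -x)
  mul : CodeFP (pairE eR eR) eR (fun p => p.1 * p.2)

namespace RingCodeFP

variable {R : Type} [CommRing R] {eR : R → List Bool} {α : Type} {eα : α → List Bool}

/-- Pointwise sum. [folklore] -/
theorem add' (h : RingCodeFP eR) {g k : α → R} (hg : CodeFP eα eR g) (hk : CodeFP eα eR k) :
    CodeFP eα eR (fun a => g a + k a) := by exact (h.add.comp (hg.pair hk) :)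

/-- Pointwise negation. [folklore] -/
theorem neg' (h : RingCodeFP eR) {g : α → R} (hg : CodeFP eα eR g) : CodeFP eα eR (fun a => -g a) := by
  exact (h.neg.comp hg :)

/-- Pointwise difference. [folklore] -/
theorem sub' (h : RingCodeFP eR) {g k : α → R} (hg : CodeFP eα eR g) (hk : CodeFP eα eR k) :
    CodeFP eα eR (fun a => g a - k a) := (h.add' hg (h.neg' hk)).congr fun _ => (sub_eq_add_neg _ _).symm

/-- Pointwise product. [folklore] -/
theorem mul' (h : RingCodeFP eR) {g k : α → R} (hg : CodeFP eα eR g) (hk : CodeFP eα eR k) :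
    CodeFP eα eR (fun a => g a * k a) := by exact (h.mul.comp (hg.pair hk) :)

/-- Difference on pairs. [folklore] -/
theorem sub (h : RingCodeFP eR) : CodeFP (pairE eR eR) eR (fun p => p.1 - p.2) := h.sub' (fst eR eR) (snd eR eR)

omit [CommRing R] in
/-- A constant. [folklore] -/
theorem const' (r : R) : CodeFP eα eR (fun _ => r) := CodeFP.const eα r

/-- Equality test. [folklore] -/
theorem eqTest [DecidableEq R] (h : RingCodeFP eR) : CodeFP (pairE eR eR) bitE (fun p => decide (p.1 = p.2)) := CodeFP.eq h.inj

/-- **The integers are a ring computed on codes.** [cite: AroraBarak2009, §1.3] -/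
theorem int : RingCodeFP intE := ⟨intE_injective, intAdd, intNeg, intMul⟩

end RingCodeFP

/-! ### Quadratic algebras on codes -/

/-- **The code of an element of a quadratic algebra**: the pair of the codes of its coordinates. [folklore] -/
def qaE {R : Type} [CommRing R] {a b : R} (eR : R → List Bool) : QuadraticAlgebra R a b → List Bool :=
  fun z => pairE eR eR (z.re, z.im)

namespace RingCodeFP

variable {R : Type} [CommRing R] {a b : R} {eR : R → List Bool} {α : Type} {eα : α → List Bool}

/-- The coordinates as a pair (same code). [folklore] -/
theorem qaCoords : CodeFP (qaE (a := a) (b := b) eR) (pairE eR eR) (fun z => (z.re, z.im)) :=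
  CodeFP.transparent fun _ => rfl

/-- The element with given coordinates (same code). [folklore] -/
theorem qaMk : CodeFP (pairE eR eR) (qaE (a := a) (b := b) eR) (fun p => (⟨p.1, p.2⟩ : QuadraticAlgebra R a b)) :=
  CodeFP.transparent fun _ => rfl

/-- The first coordinate. [folklore] -/
theorem qaRe : CodeFP (qaE (a := a) (b := b) eR) eR QuadraticAlgebra.re := (fst eR eR).comp qaCoords

/-- The second coordinate. [folklore] -/
theorem qaIm : CodeFP (qaE (a := a) (b := b) eR) eR QuadraticAlgebra.im := (snd eR eR).comp qaCoords

/-- Building an element pointwise. [folklore] -/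
theorem qaMk' {g k : α → R} (hg : CodeFP eα eR g) (hk : CodeFP eα eR k) :
    CodeFP eα (qaE (a := a) (b := b) eR) (fun x => (⟨g x, k x⟩ : QuadraticAlgebra R a b)) := qaMk.comp (hg.pair hk)

/-- `qaE` is injective for an injective coordinate code. [folklore] -/
theorem qaE_injective (h : Function.Injective eR) : Function.Injective (qaE (a := a) (b := b) eR) := by
  intro x y hxy
  obtain ⟨h1, h2⟩ := Prod.mk.inj (pairE_injective h h hxy)
  exact QuadraticAlgebra.ext h1 h2

/-- **The quadratic algebra over a ring computed on codes is a ring computed on codes.** [cite: AroraBarak2009, §1.3] -/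
theorem qa (h : RingCodeFP eR) (a b : R) : RingCodeFP (qaE (a := a) (b := b) eR) := by
  have hre1 : CodeFP (pairE (qaE (a := a) (b := b) eR) (qaE (a := a) (b := b) eR)) eR (fun p => p.1.re) := qaRe.comp (fst _ _)
  have him1 : CodeFP (pairE (qaE (a := a) (b := b) eR) (qaE (a := a) (b := b) eR)) eR (fun p => p.1.im) := qaIm.comp (fst _ _)
  have hre2 : CodeFP (pairE (qaE (a := a) (b := b) eR) (qaE (a := a) (b := b) eR)) eR (fun p => p.2.re) := qaRe.comp (snd _ _)
  have him2 : CodeFP (pairE (qaE (a := a) (b := b) eR) (qaE (a := a) (b := b) eR)) eR (fun p => p.2.im) := qaIm.comp (snd _ _)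
  refine ⟨qaE_injective h.inj, ?_, ?_, ?_⟩
  · exact (qaMk' (h.add' hre1 hre2) (h.add' him1 him2)).congr fun p => by ext <;> rfl
  · exact (qaMk' (h.neg' qaRe) (h.neg' qaIm)).congr fun z => by ext <;> rfl
  · refine (qaMk' (h.add' (h.mul' hre1 hre2) (h.mul' (const' a) (h.mul' him1 him2)))
      (h.add' (h.add' (h.mul' hre1 him2) (h.mul' him1 hre2)) (h.mul' (const' b) (h.mul' him1 him2)))).congr fun p => ?_
    ext
    · simp [QuadraticAlgebra.re_mul]; ring
    · simp [QuadraticAlgebra.im_mul]; ring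

/-- The conjugation `star z = ⟨re + b·im, -im⟩` is computed on codes. [folklore] -/
theorem qaStar (h : RingCodeFP eR) : CodeFP (qaE (a := a) (b := b) eR) (qaE (a := a) (b := b) eR) star :=
  (qaMk' (h.add' qaRe (h.mul' (const' b) qaIm)) (h.neg' qaIm)).congr fun z => by
    ext
    · simp [QuadraticAlgebra.re_star]
    · simp [QuadraticAlgebra.im_star]

end RingCodeFP

/-! ### The four golden rings -/

/-- The code of `ℤ[φ]`. [folklore] -/
abbrev zphiE : ZPhi → List Bool := qaE intE

/-- The code of `ℤ[φ][√τ]`. [folklore] -/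
abbrev zphisE : ZPhiS → List Bool := qaE zphiE

/-- The code of `ℤ[φ][ζ₅]`. [folklore] -/
abbrev zzE : ZPhiZeta → List Bool := qaE zphiE

/-- The code of `K5 = ℤ[φ][ζ₅][√τ]`. [folklore] -/
abbrev k5E : K5 → List Bool := qaE zzE

/-- `ℤ[φ]` is computed on codes. [cite: AharonovArad2011, §3.3] -/
theorem zphiRing : RingCodeFP zphiE := RingCodeFP.int.qa 1 1

/-- `ℤ[φ][√τ]` is computed on codes. [cite: AharonovArad2011, §3.3] -/
theorem zphisRing : RingCodeFP zphisE := zphiRing.qa ZPhi.tau 0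

/-- `ℤ[φ][ζ₅]` is computed on codes. [cite: AharonovArad2011, §3.3] -/
theorem zzRing : RingCodeFP zzE := zphiRing.qa (-1) ZPhi.tau

/-- `K5` is computed on codes. [cite: AharonovArad2011, §3.3] -/
theorem k5Ring : RingCodeFP k5E := zzRing.qa (QuadraticAlgebra.C ZPhi.tau) 0

/-! ### The sign tests -/

/-- **The `√5` sign test is computed on codes.** [folklore] -/
theorem posSqrtFive_codeFP : CodeFP (pairE intE intE) bitE (fun p => ZPhi.posSqrtFive p.1 p.2) := by
  have hx : CodeFP (pairE intE intE) intE Prod.fst := fst _ _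
  have hy : CodeFP (pairE intE intE) intE Prod.snd := snd _ _
  have h0 : CodeFP (pairE intE intE) intE (fun _ => (0 : ℤ)) := const _ 0
  have c1 : CodeFP (pairE intE intE) bitE (fun p => decide ((0 : ℤ) ≤ p.2)) := by exact (intLe.comp (h0.pair hy) :)
  have c2 : CodeFP (pairE intE intE) bitE (fun p => decide ((0 : ℤ) ≤ p.1)) := by exact (intLe.comp (h0.pair hx) :)
  have c3 : CodeFP (pairE intE intE) bitE (fun p => decide ((0 : ℤ) < p.1)) := by exact (intLt.comp (h0.pair hx) :)
  have exx : CodeFP (pairE intE intE) intE (fun p => p.1 * p.1) := RingCodeFP.int.mul' hx hx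
  have eyy : CodeFP (pairE intE intE) intE (fun p => 5 * p.2 * p.2) :=
    RingCodeFP.int.mul' (RingCodeFP.int.mul' (RingCodeFP.const' 5) hy) hy
  have t1 : CodeFP (pairE intE intE) bitE (fun p => decide (p.1 = (0 : ℤ))) := by exact (intEq.comp (hx.pair h0) :)
  have t2 : CodeFP (pairE intE intE) bitE (fun p => decide (p.2 = (0 : ℤ))) := by exact (intEq.comp (hy.pair h0) :)
  have b1 : CodeFP (pairE intE intE) bitE (fun p => !decide (p.1 = (0 : ℤ)) || !decide (p.2 = (0 : ℤ))) := t1.not.or t2.not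
  have b2 : CodeFP (pairE intE intE) bitE (fun p => decide (p.1 * p.1 < 5 * p.2 * p.2)) := by exact (intLt.comp (exx.pair eyy) :)
  have b3 : CodeFP (pairE intE intE) bitE (fun p => decide (5 * p.2 * p.2 < p.1 * p.1)) := by exact (intLt.comp (eyy.pair exx) :)
  refine ((c1.ite (c2.ite b1 b2) (c3.ite b3 (const _ false))).congr fun p => ?_)
  obtain ⟨x, y⟩ := p
  unfold ZPhi.posSqrtFive
  by_cases hy0 : 0 ≤ y <;> by_cases hx0 : 0 ≤ x <;> by_cases hx1 : 0 < x <;> simp [hy0, hx0, hx1]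

/-- **The sign of `ℤ[φ]` is computed on codes.** [cite: AharonovArad2011, §3.3] -/
theorem zphiPos : CodeFP zphiE bitE ZPhi.pos :=
  (posSqrtFive_codeFP.comp ((RingCodeFP.int.add' (RingCodeFP.int.mul' (RingCodeFP.const' 2) RingCodeFP.qaRe) RingCodeFP.qaIm).pair
    RingCodeFP.qaIm)).congr fun _ => rfl

/-- The order test of `ℤ[φ]` is computed on codes. [cite: AharonovArad2011, §3.3] -/
theorem zphiLt : CodeFP (pairE zphiE zphiE) bitE (fun p => ZPhi.lt p.1 p.2) :=
  (zphiPos.comp (zphiRing.sub' (snd _ _) (fst _ _))).congr fun _ => rfl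

/-- Pointwise order test of `ℤ[φ]`. [folklore] -/
theorem zphiLt' {α : Type} {eα : α → List Bool} {g k : α → ZPhi} (hg : CodeFP eα zphiE g) (hk : CodeFP eα zphiE k) :
    CodeFP eα bitE (fun a => ZPhi.lt (g a) (k a)) := by exact (zphiLt.comp (hg.pair hk) :)

/-- **The sign of `ℤ[φ][√τ]` is computed on codes.** [cite: AharonovArad2011, §3.3] -/
theorem zphisPos : CodeFP zphisE bitE ZPhiS.pos := by
  have hre : CodeFP zphisE zphiE QuadraticAlgebra.re := RingCodeFP.qaRe
  have him : CodeFP zphisE zphiE QuadraticAlgebra.im := RingCodeFP.qaIm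
  have c1 : CodeFP zphisE bitE (fun z => ZPhi.pos (-z.im)) := zphiPos.comp (zphiRing.neg' him)
  have c2 : CodeFP zphisE bitE (fun z => ZPhi.pos (-z.re)) := zphiPos.comp (zphiRing.neg' hre)
  have pre : CodeFP zphisE bitE (fun z => ZPhi.pos z.re) := zphiPos.comp hre
  have pim : CodeFP zphisE bitE (fun z => ZPhi.pos z.im) := zphiPos.comp him
  have sre : CodeFP zphisE zphiE (fun z => z.re * z.re) := zphiRing.mul' hre hre
  have sim : CodeFP zphisE zphiE (fun z => z.im * z.im * ZPhi.tau) := zphiRing.mul' (zphiRing.mul' him him) (RingCodeFP.const' _)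
  exact ((c1.ite (pre.and (zphiLt' sim sre)) (c2.ite (zphiLt' sre sim) (pre.or pim))).congr fun z => by
    unfold ZPhiS.pos; rfl)

/-- **The order test of `ℤ[φ][√τ]` is computed on codes** (the compiler's only decision). [cite: AharonovArad2011, §3.3] -/
theorem zphisLt : CodeFP (pairE zphisE zphisE) bitE (fun p => ZPhiS.lt p.1 p.2) :=
  (zphisPos.comp (zphisRing.sub' (snd _ _) (fst _ _))).congr fun _ => rfl

/-- Pointwise order test of `ℤ[φ][√τ]`. [folklore] -/
theorem zphisLt' {α : Type} {eα : α → List Bool} {g k : α → ZPhiS} (hg : CodeFP eα zphisE g) (hk : CodeFP eα zphisE k) :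
    CodeFP eα bitE (fun a => ZPhiS.lt (g a) (k a)) := by exact (zphisLt.comp (hg.pair hk) :)

end Literature.Computability.QuantumComplexity
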